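import Literature.RepresentationTheory.FiniteGroups.SymmetricGroupCharacterDegreeCoeff
import Literature.RepresentationTheory.FiniteGroups.VershikKerovMaxDegreeProofs
import Literature.NumberTheory.DiophantineGeometry.GLHighestWeightFacts
import HarnessLib

/-!
# The squared coefficients of the antisymmetric polynomial `a_ρ · p_1^n` in `N` variables sum to `N! · Σ_{μ ⊢ n, ℓ(μ) ≤ N} (f^μ)²`

HONEST FRAMING: exact (Metropolis-corrected) sampling algorithms for lattice gauge theory;
figures of merit are autocorrelation/cost numbers at stated couplings and volumes; no
continuum-physics claim.

Venture `LatticeQCDFlow` (cell pub-lqcd), sub-topic `Scoring`; FANOUT row 5 (`s0-sun-a`), GEN-23.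
NEW WORK of the cell (placement rule).  The algebraic half of the exact even trace moments of a Haar
unitary (`UNHaarTraceMomentsTableaux`): by Weyl's integration formula and Parseval on the torus,
`∫_{U(N)} |tr U|^{2n} dU` is `(1/N!)` times the sum of the squares of the coefficients of the
antisymmetric integer polynomial `G = a_ρ(x) · p_1(x)^n` in `N` variables (`a_ρ` the Vandermonde
alternant, `p_1 = x_1 + ⋯ + x_N`).  This file computes that sum from the tree's symmetric-group
library (`Literature/RepresentationTheory/FiniteGroups/`): `G` is antisymmetric
(`rename_prod_psum_mul_alternant_mul_pow`), so it has no monomial with a repeated exponent and its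
coefficients are constant up to sign on each `N!`-element orbit of an injective exponent vector; the
sorted representatives are the `λ + ρ`, `λ` antitone of size `n` (the tree's
`sum_piAntidiag_eq_sum_antitoneWeights`), i.e. `λ` a partition of `n` with at most `N` parts
(`Weight.existsUnique_eq_ofPartition_holds`), and there the coefficient is the number `f^λ` of standard
Young tableaux — Frobenius's character formula at the identity, the tree's
`coeff_alternant_mul_psum_one_pow`.  Hence

* `sum_support_coeff_sq_alternant_mul_psum_pow`:
  **`Σ_d ([x^d] a_ρ p_1^n)² = N! · Σ_{μ ⊢ n, ℓ(μ) ≤ N} (f^μ)²`**;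
* `sum_filter_sq_numStandardTableaux_le` / `_eq`: `Σ_{μ ⊢ n, ℓ(μ) ≤ N} (f^μ)² ≤ n!`, with equality for
  `n ≤ N` (the tree's `sum_sq_numStandardTableaux`: `Σ_{μ ⊢ n} (f^μ)² = n!`).

References (context only; everything here is proved from the tree): W. Fulton, J. Harris,
*Representation Theory*, GTM 129, Thm. 4.10 / (4.11); E. M. Rains, *Increasing subsequences and the
classical groups*, Electron. J. Combin. 5 (1998) R12, Thm. 1.1.  No `def`, no named fact, 0 sorry.
-/

noncomputable section

open Finset Equiv
open Literature.RingTheory.SymmetricFunctions.SymmPoly (alternant rho antitoneWeights mem_antitoneWeights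
  sum_piAntidiag_eq_sum_antitoneWeights)
open Literature.RepresentationTheory.FiniteGroups (coeff_alternant_mul_psum_one_pow
  rename_prod_psum_mul_alternant_mul_pow coeff_eq_zero_of_antisymm_of_apply_eq sum_sq_numStandardTableaux)
open Literature.NumberTheory.DiophantineGeometry (numStandardTableaux)

namespace Summit.Ventures.LatticeQCDFlow.Scoring

variable {N : ℕ}

/-! ### 1. Antisymmetry, vanishing and orbit-constancy of the coefficients; homogeneity -/

/-- `a_ρ · p_1^n` is antisymmetric. -/
theorem rename_alternant_mul_psum_pow (n : ℕ) (g : Perm (Fin N)) :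
    MvPolynomial.rename g (alternant (fun i => (MvPolynomial.X i : MvPolynomial (Fin N) ℤ)) (rho N) *
        MvPolynomial.psum (Fin N) ℤ 1 ^ n)
      = ((Equiv.Perm.sign g : ℤ) : MvPolynomial (Fin N) ℤ) *
          (alternant (fun i => (MvPolynomial.X i : MvPolynomial (Fin N) ℤ)) (rho N) *
            MvPolynomial.psum (Fin N) ℤ 1 ^ n) := by
  have h := rename_prod_psum_mul_alternant_mul_pow [] n g
  simp only [List.map_nil, List.prod_nil, one_mul] at h
  exact h

/-- `a_ρ · p_1^n` has no monomial with a repeated exponent. -/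
theorem coeff_alternant_mul_psum_pow_eq_zero (n : ℕ) {d : Fin N →₀ ℕ} (hd : ¬ Function.Injective d) :
    MvPolynomial.coeff d (alternant (fun i => (MvPolynomial.X i : MvPolynomial (Fin N) ℤ)) (rho N) *
        MvPolynomial.psum (Fin N) ℤ 1 ^ n) = 0 := by
  obtain ⟨i, j, hij', hij⟩ := Function.not_injective_iff.mp hd
  exact coeff_eq_zero_of_antisymm_of_apply_eq hij (rename_alternant_mul_psum_pow n _) hij'

/-- Permuting an exponent vector does not change the square of its coefficient in `a_ρ · p_1^n`. -/
theorem coeff_mapDomain_alternant_mul_psum_pow_sq (n : ℕ) (d : Fin N →₀ ℕ) (g : Perm (Fin N)) :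
    MvPolynomial.coeff (Finsupp.mapDomain g d)
        (alternant (fun i => (MvPolynomial.X i : MvPolynomial (Fin N) ℤ)) (rho N) *
          MvPolynomial.psum (Fin N) ℤ 1 ^ n) ^ 2
      = MvPolynomial.coeff d (alternant (fun i => (MvPolynomial.X i : MvPolynomial (Fin N) ℤ)) (rho N) *
          MvPolynomial.psum (Fin N) ℤ 1 ^ n) ^ 2 := by
  have h := MvPolynomial.coeff_rename_mapDomain g g.injective
    (alternant (fun i => (MvPolynomial.X i : MvPolynomial (Fin N) ℤ)) (rho N) *
      MvPolynomial.psum (Fin N) ℤ 1 ^ n) d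
  have hC : ((Equiv.Perm.sign g : ℤ) : MvPolynomial (Fin N) ℤ) = MvPolynomial.C (Equiv.Perm.sign g : ℤ) := by
    simp
  rw [rename_alternant_mul_psum_pow, hC, MvPolynomial.coeff_C_mul] at h
  rw [← h, mul_pow, ← Units.val_pow_eq_pow_val, Int.units_sq, Units.val_one, one_mul]

/-- `a_ρ · p_1^n` is homogeneous of degree `|ρ| + n`. -/
theorem isHomogeneous_alternant_mul_psum_pow (n : ℕ) :
    (alternant (fun i => (MvPolynomial.X i : MvPolynomial (Fin N) ℤ)) (rho N) *
        MvPolynomial.psum (Fin N) ℤ 1 ^ n).IsHomogeneous ((∑ i, rho N i) + n) := by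
  refine MvPolynomial.IsHomogeneous.mul ?_ ?_
  · rw [Literature.RepresentationTheory.FiniteGroups.alternant_X_eq_sum_monomial]
    refine MvPolynomial.IsHomogeneous.sum _ _ _ fun τ _ => ?_
    have hC : ((Equiv.Perm.sign τ : ℤ) : MvPolynomial (Fin N) ℤ) = MvPolynomial.C (Equiv.Perm.sign τ : ℤ) := by
      simp
    rw [hC, MvPolynomial.C_mul_monomial]
    refine MvPolynomial.isHomogeneous_monomial _ ?_
    rw [Finsupp.degree_eq_sum]
    simp only [Finsupp.coe_equivFunOnFinite_symm]
    exact Equiv.sum_comp τ⁻¹ (rho N)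
  · have h1 : (MvPolynomial.psum (Fin N) ℤ 1).IsHomogeneous 1 := by
      rw [MvPolynomial.psum_one]
      exact MvPolynomial.IsHomogeneous.sum _ _ _ fun i _ => MvPolynomial.isHomogeneous_X ℤ i
    simpa using h1.pow n

/-! ### 2. Sorting the exponents: partitions of `n` with at most `N` parts -/

/-- Every antitone weight of size `d` with at most `N` rows lists the parts of a partition of `d`. -/
theorem exists_partition_of_mem_antitoneWeights {d : ℕ} {la : Fin N → ℕ} (hla : la ∈ antitoneWeights N d) :
    ∃ μ : Nat.Partition d, μ.parts.card ≤ N ∧ (fun i : Fin N => μ.sortedParts.getD i 0) = la := by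
  rw [mem_antitoneWeights] at hla
  have hpol : Literature.NumberTheory.DiophantineGeometry.Weight.IsPolynomial (fun i => (la i : ℤ)) :=
    ⟨fun i j hij => by
      show (la j : ℤ) ≤ la i
      exact_mod_cast hla.2 hij, fun i => by positivity⟩
  obtain ⟨μ, ⟨hμN, hμ⟩, -⟩ :=
    Literature.NumberTheory.DiophantineGeometry.Weight.existsUnique_eq_ofPartition_holds hpol
  have hd : (Literature.NumberTheory.DiophantineGeometry.Weight.size (fun i => (la i : ℤ))).toNat = d := by
    rw [Literature.NumberTheory.DiophantineGeometry.Weight.size, ← Nat.cast_sum, hla.1, Int.toNat_natCast]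
  subst hd
  refine ⟨μ, hμN, funext fun i => ?_⟩
  have hi := congrFun hμ i
  rw [Literature.NumberTheory.DiophantineGeometry.Weight.ofPartition_apply] at hi
  exact_mod_cast hi

/-- Reindexing the antitone weights of size `n` with at most `N` rows by the partitions of `n` with at most
`N` parts, the coefficient `[x^{λ+ρ}](a_ρ · p_1^n)` being the number `f^λ` of standard Young tableaux. -/
theorem sum_antitoneWeights_coeff_sq (n : ℕ) :
    ∑ la ∈ antitoneWeights N n,
        MvPolynomial.coeff (Finsupp.equivFunOnFinite.symm (la + rho N))
          (alternant (fun i => (MvPolynomial.X i : MvPolynomial (Fin N) ℤ)) (rho N) *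
            MvPolynomial.psum (Fin N) ℤ 1 ^ n) ^ 2
      = ∑ μ ∈ univ.filter (fun μ : Nat.Partition n => μ.parts.card ≤ N), (numStandardTableaux μ : ℤ) ^ 2 := by
  symm
  refine Finset.sum_bij (fun μ _ => fun i : Fin N => μ.sortedParts.getD i 0) ?_ ?_ ?_ ?_
  · intro μ hμ
    rw [mem_filter] at hμ
    rw [mem_antitoneWeights]
    constructor
    · have h := Literature.NumberTheory.DiophantineGeometry.Weight.size_ofPartition_holds hμ.2
      change ∑ i : Fin N, ((μ.sortedParts.getD i 0 : ℕ) : ℤ) = n at h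
      exact_mod_cast h
    · intro i j hij
      have h := (Literature.NumberTheory.DiophantineGeometry.Weight.isPolynomial_ofPartition_holds N μ).1 hij
      rw [Literature.NumberTheory.DiophantineGeometry.Weight.ofPartition_apply,
        Literature.NumberTheory.DiophantineGeometry.Weight.ofPartition_apply] at h
      show μ.sortedParts.getD j 0 ≤ μ.sortedParts.getD i 0
      exact_mod_cast h
  · intro μ hμ ν hν h
    rw [mem_filter] at hμ hν
    exact Literature.NumberTheory.DiophantineGeometry.Weight.ofPartition_injOn_holds N n hμ.2 hν.2
      (funext fun i => congrArg (Nat.cast : ℕ → ℤ) (congrFun h i))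
  · intro la hla
    obtain ⟨μ, hμN, hμ⟩ := exists_partition_of_mem_antitoneWeights hla
    exact ⟨μ, mem_filter.mpr ⟨mem_univ _, hμN⟩, hμ⟩
  · intro μ hμ
    rw [mem_filter] at hμ
    rw [coeff_alternant_mul_psum_one_pow μ hμ.2]

/-- **The squared coefficients of `a_ρ · p_1^n` sum to `N! · Σ_{μ ⊢ n, ℓ(μ) ≤ N} (f^μ)²`**: an
antisymmetric polynomial has no monomial with a repeated exponent, its coefficients are constant up to sign
on each of the `N!`-element orbits of the injective exponents, and on the sorted representative `λ + ρ` the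
coefficient is `f^λ` (Frobenius's formula at the identity, the tree's `coeff_alternant_mul_psum_one_pow`). -/
theorem sum_support_coeff_sq_alternant_mul_psum_pow (n : ℕ) :
    ∑ d ∈ (alternant (fun i => (MvPolynomial.X i : MvPolynomial (Fin N) ℤ)) (rho N) *
          MvPolynomial.psum (Fin N) ℤ 1 ^ n).support,
        MvPolynomial.coeff d (alternant (fun i => (MvPolynomial.X i : MvPolynomial (Fin N) ℤ)) (rho N) *
          MvPolynomial.psum (Fin N) ℤ 1 ^ n) ^ 2
      = (N.factorial : ℤ) *
          ∑ μ ∈ univ.filter (fun μ : Nat.Partition n => μ.parts.card ≤ N), (numStandardTableaux μ : ℤ) ^ 2 := by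
  set G := alternant (fun i => (MvPolynomial.X i : MvPolynomial (Fin N) ℤ)) (rho N) *
    MvPolynomial.psum (Fin N) ℤ 1 ^ n with hG
  set F : (Fin N → ℕ) → ℤ := fun m => MvPolynomial.coeff (Finsupp.equivFunOnFinite.symm m) G ^ 2 with hF
  -- the support sum is the sum over the antidiagonal of the degree
  have h1 : ∑ d ∈ G.support, MvPolynomial.coeff d G ^ 2 = ∑ m ∈ piAntidiag univ (n + ∑ i, rho N i), F m := by
    refine Finset.sum_bij_ne_zero (fun d _ _ => ⇑d) (fun d hd _ => ?_)
      (fun d₁ _ _ d₂ _ _ h => DFunLike.coe_injective h) (fun m hm hne => ?_) (fun d _ _ => ?_)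
    · rw [Finset.mem_piAntidiag]
      refine ⟨?_, fun i _ => Finset.mem_univ i⟩
      have hdeg : d.degree = (∑ i, rho N i) + n := by
        by_contra hne'
        exact (MvPolynomial.mem_support_iff.mp hd) ((isHomogeneous_alternant_mul_psum_pow n).coeff_eq_zero hne')
      rw [← Finsupp.degree_eq_sum, hdeg, add_comm]
    · have hne' : MvPolynomial.coeff (Finsupp.equivFunOnFinite.symm m) G ≠ 0 := fun h0 => hne (by
        rw [hF]; dsimp only; rw [h0]; ring)
      exact ⟨Finsupp.equivFunOnFinite.symm m, MvPolynomial.mem_support_iff.mpr hne', pow_ne_zero 2 hne',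
        Finsupp.coe_equivFunOnFinite_symm m⟩
    · rw [hF]; dsimp only
      rw [Finsupp.equivFunOnFinite_symm_coe]
  have hF0 : ∀ m : Fin N → ℕ, ¬ Function.Injective m → F m = 0 := fun m hm => by
    rw [hF]; dsimp only
    rw [coeff_alternant_mul_psum_pow_eq_zero n (by rwa [Finsupp.coe_equivFunOnFinite_symm]), zero_pow two_ne_zero]
  have h2 := sum_piAntidiag_eq_sum_antitoneWeights F hF0 n
  have h3 : ∀ la : Fin N → ℕ, ∀ τ : Perm (Fin N), F ((la + rho N) ∘ τ) = F (la + rho N) := by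
    intro la τ
    rw [hF]; dsimp only
    have he : Finsupp.equivFunOnFinite.symm ((la + rho N) ∘ ⇑τ) =
        Finsupp.mapDomain (τ.symm : Perm (Fin N)) (Finsupp.equivFunOnFinite.symm (la + rho N)) := by
      ext a
      simp only [Finsupp.coe_equivFunOnFinite_symm, Finsupp.mapDomain_equiv_apply, Equiv.symm_symm,
        Function.comp_apply]
    rw [he, coeff_mapDomain_alternant_mul_psum_pow_sq]
  simp_rw [h3, Finset.sum_const, Finset.card_univ, Fintype.card_perm, Fintype.card_fin] at h2
  rw [h1, h2, ← sum_antitoneWeights_coeff_sq n, Finset.mul_sum]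
  refine Finset.sum_congr rfl fun la _ => ?_
  rw [nsmul_eq_mul]

/-- **`Σ_{μ ⊢ n, ℓ(μ) ≤ N} (f^μ)² ≤ n!`, with equality when `n ≤ N`** (the tree's `sum_sq_numStandardTableaux`:
`Σ_{μ ⊢ n} (f^μ)² = n!`; a partition of `n` has at most `n` parts). -/
theorem sum_filter_sq_numStandardTableaux_le (N n : ℕ) :
    ∑ μ ∈ univ.filter (fun μ : Nat.Partition n => μ.parts.card ≤ N), numStandardTableaux μ ^ 2 ≤ n.factorial := by
  rw [← sum_sq_numStandardTableaux n]
  exact Finset.sum_le_sum_of_subset_of_nonneg (Finset.filter_subset _ _) fun _ _ _ => Nat.zero_le _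

/-- For `n ≤ N` every partition of `n` has at most `n ≤ N` parts (its parts are positive and sum to `n`):
`Σ_{μ ⊢ n, ℓ(μ) ≤ N} (f^μ)² = n!`. -/
theorem sum_filter_sq_numStandardTableaux_eq {N n : ℕ} (h : n ≤ N) :
    ∑ μ ∈ univ.filter (fun μ : Nat.Partition n => μ.parts.card ≤ N), numStandardTableaux μ ^ 2 = n.factorial := by
  rw [← sum_sq_numStandardTableaux n, Finset.filter_true_of_mem fun μ _ => ?_]
  have hμ := Multiset.card_nsmul_le_sum (s := μ.parts) (a := 1) fun x hx => μ.parts_pos hx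
  rw [smul_eq_mul, mul_one, μ.parts_sum] at hμ
  exact hμ.trans h

end Summit.Ventures.LatticeQCDFlow.Scoring
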